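import Literature.Geometry.Riemannian.GradientShrinkerProofs
import Literature.Geometry.Lorentzian.Volume
import Summits.SmoothPoincare4.SmoothPoincare4.Theorems.SubcylindricalRecognition.Negative.WindowArithmetic
import HarnessLib

/-!
# Renormalisation of a blow-down shrinker from Bamler's currency to the route's currency

Stub `stub_renormalise` of line `ancient-sphere-rigidity` for the crux
`EntropyRung.SubcylindricalRecognition` (stmt-SmoothPoincare4-10869): the fact-free algebra which
converts the complete gradient shrinking soliton delivered by the Bamler blow-down
(`stub_blowdownSoliton`) — in BAMLER'S normalisation `Ric + Hess f = g/2`, `R + |∇f|² = f − W`,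
`∫ e^{-f} dV = 16π²` (i.e. `(4π)⁻² e^{-f} dV` is a probability measure), `W ≥ ν_cyl + δ'` with
`ν_cyl = log 2 + ½ log π − 3/2 = log Θ(S³×ℝ)`, `δ' > 0`, and `R > 0` — into the ROUTE'S
normalisation consumed by the density-gap items NoncompactShrinkerGap / CompactShrinkerGap:
a potential `f̃` with the same soliton equation, `R + |∇f̃|² = f̃`, `R ≢ 0`, and
`∫ e^{-f̃} dV > 32π²√π e^{-3/2} = 16π² Θ(S³×ℝ)` STRICTLY.

## What

* `gradSq_sub_const`, `hessian_sub_const`: `|∇(u − c)|² = |∇u|²` and `Hess(u − c) = Hess u`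
  (the tree's `gradSq_add_const`, `hessian_add_const` of `GradientShrinkerProofs.lean` with `−c`);
* `lintegral_ofReal_exp_neg_sub_const`: `∫⁻ e^{-(f − W)} dμ = e^{W} ∫⁻ e^{-f} dμ` (any measure);
* `routeConstant_lt_exp_mul`: `32π²√π e^{-3/2} < e^{W} · 16π²` as soon as `ν_cyl + δ' ≤ W`,
  `δ' > 0` (`32π²√π e^{-3/2} = 16π² Θ_cyl`, `Θ_cyl = e^{ν_cyl}`: `routeConstant_eq`,
  `nuCyl_eq_log_thetaCyl` of `Negative/WindowArithmetic.lean`, and strict monotonicity of `exp`);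
* `stub_renormalise`: the registered signature, with the witness `f̃ := f − W`.

## Proof (fact-free)

Put `f̃ := f − W`. The differential of `f̃` is that of `f`, so `|∇f̃|² = |∇f|²` and
`Hess f̃ = Hess f` (chain rule with `t ↦ t − W`); hence `Ric + Hess f̃ = g/2` and
`R + |∇f̃|² = f − W = f̃`. `R ≢ 0` because `S` is non-empty (connected) and `R > 0`. Finally
`∫ e^{-f̃} dV = e^{W} ∫ e^{-f} dV = 16π² e^{W} ≥ 16π² e^{ν_cyl + δ'} > 16π² e^{ν_cyl}
= 16π² · 2√π e^{-3/2} = 32π²√π e^{-3/2}`, the strict inequality because `δ' > 0`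
(Cao–Hamilton–Ilmanen, arXiv:math/0404165, §1: `Θ(S^{n-1}×ℝ) = Θ(S^{n-1})`, here
`Θ(S³×ℝ) = 2√π e^{-3/2}`; the renormalisation `f ↦ f − W` between the probability normalisation
`∫ (4π)^{-n/2} e^{-f} = 1` and the normalisation `R + |∇f|² = f` is Carrillo–Ni 2009, Thm. 1.1 (i)).

## References

* [CarrilloNi2009] J. A. Carrillo, L. Ni, *Sharp logarithmic Sobolev inequalities on gradient
  solitons and applications*, Comm. Anal. Geom. 17 (2009) 721–753, Thm. 1.1 (i), §2 (2.2).
* [CaoHamiltonIlmanen2004] H.-D. Cao, R. S. Hamilton, T. Ilmanen, *Gaussian densities and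
  stability for some Ricci solitons*, arXiv:math/0404165, §1.
-/

noncomputable section

open scoped Manifold ContDiff Topology ENNReal NNReal
open Set MeasureTheory Literature.Geometry.Lorentzian Literature.Geometry.Riemannian

namespace Summit.SmoothPoincare4.SmoothPoincare4.Theorems.SubcylindricalRecognition.AncientSphereRigidity

section Shift

variable {E : Type*} [NormedAddCommGroup E] [NormedSpace ℝ E] [FiniteDimensional ℝ E]
  {H : Type*} [TopologicalSpace H] {I : ModelWithCorners ℝ E H} {M : Type*} [TopologicalSpace M]
  [ChartedSpace H M] [IsManifold I ∞ M]

/-- **`|∇(u − c)|² = |∇u|²`** at a point of differentiability of `u` (the differential of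
`u − c` is that of `u`; `gradSq_add_const` with `−c`). [folklore] -/
theorem gradSq_sub_const (g : PseudoRiemannianMetric I ∞ E (TangentSpace I : M → Type _)) (c : ℝ)
    {u : M → ℝ} {x : M} (hu : MDifferentiableAt I 𝓘(ℝ, ℝ) u x) :
    g.gradSq (fun y ↦ u y - c) x = g.gradSq u x := by
  simpa only [sub_eq_add_neg] using g.gradSq_add_const (-c) hu

/-- **`Hess(u − c) = Hess u`** for `u` of class `C²` at the point (the Hessian of a constant
vanishes; `hessian_add_const` with `−c`). [folklore] -/
theorem hessian_sub_const (g : PseudoRiemannianMetric I ∞ E (TangentSpace I : M → Type _))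
    [g.HasLeviCivita] (c : ℝ) {u : M → ℝ} {x : M} (hu : ContMDiffAt I 𝓘(ℝ, ℝ) 2 u x)
    (v w : TangentSpace I x) :
    g.hessian (fun y ↦ u y - c) x v w = g.hessian u x v w := by
  simpa only [sub_eq_add_neg] using g.hessian_add_const (-c) hu v w

end Shift

/-- **`∫⁻ e^{-(f − W)} dμ = e^{W} · ∫⁻ e^{-f} dμ`** (as extended non-negative reals, for any measure:
`e^{-(f − W)} = e^{W} e^{-f}` pointwise and `e^{W} < ∞` comes out of the lower integral). [folklore] -/
theorem lintegral_ofReal_exp_neg_sub_const {α : Type*} [MeasurableSpace α] (μ : Measure α)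
    (f : α → ℝ) (W : ℝ) :
    ∫⁻ x, ENNReal.ofReal (Real.exp (-(f x - W))) ∂μ =
      ENNReal.ofReal (Real.exp W) * ∫⁻ x, ENNReal.ofReal (Real.exp (-f x)) ∂μ := by
  rw [← lintegral_const_mul' _ _ ENNReal.ofReal_ne_top]
  refine lintegral_congr fun x ↦ ?_
  rw [show -(f x - W) = W + -f x by ring, Real.exp_add, ENNReal.ofReal_mul (Real.exp_pos W).le]

open Negative in
/-- **The cylinder threshold, exponentiated**: if `ν_cyl + δ' ≤ W` with `δ' > 0`
(`ν_cyl = log 2 + ½ log π − 3/2`), then `32π²√π e^{-3/2} < e^{W} · 16π²` — indeed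
`32π²√π e^{-3/2} = 16π² Θ_cyl` (`routeConstant_eq`), `Θ_cyl = e^{ν_cyl}` (`nuCyl_eq_log_thetaCyl`)
and `ν_cyl < W`. [folklore] -/
theorem routeConstant_lt_exp_mul {W δ' : ℝ} (hδ' : 0 < δ')
    (hW : Real.log 2 + Real.log Real.pi / 2 - 3 / 2 + δ' ≤ W) :
    32 * Real.pi ^ 2 * Real.sqrt Real.pi * Real.exp (-(3 : ℝ) / 2) <
      Real.exp W * (16 * Real.pi ^ 2) := by
  rw [routeConstant_eq]
  have hθ : 0 < thetaCyl := by unfold thetaCyl; positivity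
  have hexp : thetaCyl = Real.exp nuCyl := by rw [nuCyl_eq_log_thetaCyl, Real.exp_log hθ]
  have hlt : nuCyl < W := by unfold nuCyl; linarith
  have hmono : Real.exp nuCyl < Real.exp W := Real.exp_lt_exp.2 hlt
  have hpos : (0 : ℝ) < 16 * Real.pi ^ 2 := by positivity
  rw [hexp]
  nlinarith [mul_lt_mul_of_pos_left hmono hpos]

/-- **Renormalisation to the route's currency** (registered stub `stub_renormalise` of line
`ancient-sphere-rigidity`): on a connected `4`-manifold `S` with a `C^∞` Riemannian metric `gS`
(Levi-Civita instance) and a smooth `f` in Bamler's normalisation — `Ric + Hess f = gS/2`,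
`R + |∇f|² = f − W`, `∫ e^{-f} dV = 16π²`, `log 2 + ½ log π − 3/2 + δ' ≤ W` with `δ' > 0`, `R > 0` —
the shifted potential `fS := f − W` is smooth, satisfies the same soliton equation
(`hessian_sub_const`) and `R + |∇fS|² = fS` (`gradSq_sub_const`), `R ≢ 0` (`S` is non-empty), and
`∫ e^{-fS} dV = e^{W} · 16π² > 32π²√π e^{-3/2}` (`lintegral_ofReal_exp_neg_sub_const`,
`routeConstant_lt_exp_mul`). [cite: CarrilloNi2009, Thm. 1.1 (i) and §2 (2.2)] -/
theorem stub_renormalise :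
    ∀ (S : Type) [TopologicalSpace S] [T2Space S] [SecondCountableTopology S]
      [ChartedSpace (EuclideanSpace ℝ (Fin 4)) S] [IsManifold (𝓡 4) ∞ S] [ConnectedSpace S]
      [T3Space S] [MeasurableSpace S] [BorelSpace S]
      (gS : PseudoRiemannianMetric (𝓡 4) ∞ (EuclideanSpace ℝ (Fin 4)) (TangentSpace (𝓡 4) : S → Type _))
      [gS.HasLeviCivita] (f : S → ℝ) (hS : gS.IsRiemannian) (W δ' : ℝ), 0 < δ' →
      ContMDiff (𝓡 4) 𝓘(ℝ, ℝ) ∞ f →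
      (∀ (x : S) (X Y : TangentSpace (𝓡 4) x),
        gS.ricci x X Y + gS.hessian f x X Y = (1 / 2 : ℝ) * gS.val x X Y) →
      (∀ x : S, gS.scalarCurvature x + gS.gradSq f x = f x - W) →
      ∫⁻ x, ENNReal.ofReal (Real.exp (-f x))
          ∂(riemannianMeasure (gS.toContMDiffRiemannianMetric hS)) =
        ENNReal.ofReal (16 * Real.pi ^ 2) →
      Real.log 2 + Real.log Real.pi / 2 - 3 / 2 + δ' ≤ W →
      (∀ x : S, 0 < gS.scalarCurvature x) →
      ∃ fS : S → ℝ,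
        ContMDiff (𝓡 4) 𝓘(ℝ, ℝ) ∞ fS ∧
        (∀ (x : S) (X Y : TangentSpace (𝓡 4) x),
          gS.ricci x X Y + gS.hessian fS x X Y = (1 / 2 : ℝ) * gS.val x X Y) ∧
        (∀ x : S, gS.scalarCurvature x + gS.gradSq fS x = fS x) ∧
        (∃ x : S, gS.scalarCurvature x ≠ 0) ∧
        ENNReal.ofReal (32 * Real.pi ^ 2 * Real.sqrt Real.pi * Real.exp (-(3 : ℝ) / 2)) <
          ∫⁻ x, ENNReal.ofReal (Real.exp (-fS x))
            ∂(riemannianMeasure (gS.toContMDiffRiemannianMetric hS)) := by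
  intro S _ _ _ _ _ _ _ _ _ gS _ f hS W δ' hδ' hf hsol hnorm hint hW hR
  -- (i) smoothness of `f − W`
  have h1 : ContMDiff (𝓡 4) 𝓘(ℝ, ℝ) ∞ (fun y ↦ f y - W) := hf.sub contMDiff_const
  -- (ii) the soliton equation is unchanged: `Hess(f − W) = Hess f`
  have h2 : ∀ (x : S) (X Y : TangentSpace (𝓡 4) x),
      gS.ricci x X Y + gS.hessian (fun y ↦ f y - W) x X Y = (1 / 2 : ℝ) * gS.val x X Y := by
    intro x X Y
    have hfx : ContMDiffAt (𝓡 4) 𝓘(ℝ, ℝ) 2 f x := (hf.of_le ENat.LEInfty.out).contMDiffAt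
    rw [hessian_sub_const gS W hfx X Y]
    exact hsol x X Y
  -- (iii) the route's normalisation: `R + |∇(f − W)|² = R + |∇f|² = f − W`
  have h3 : ∀ x : S, gS.scalarCurvature x + gS.gradSq (fun y ↦ f y - W) x = f x - W := by
    intro x
    rw [gradSq_sub_const gS W (hf.mdifferentiableAt (by norm_num))]
    exact hnorm x
  -- (iv) `R ≢ 0`: `S` is non-empty (connected) and `R > 0`
  have h4 : ∃ x : S, gS.scalarCurvature x ≠ 0 := by
    obtain ⟨x⟩ : Nonempty S := inferInstance
    exact ⟨x, (hR x).ne'⟩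
  -- (v) `∫ e^{-(f − W)} dV = e^{W} · 16π² > 32π²√π e^{-3/2}`
  have h5 : ENNReal.ofReal (32 * Real.pi ^ 2 * Real.sqrt Real.pi * Real.exp (-(3 : ℝ) / 2)) <
      ∫⁻ x, ENNReal.ofReal (Real.exp (-(f x - W)))
        ∂(riemannianMeasure (gS.toContMDiffRiemannianMetric hS)) := by
    rw [lintegral_ofReal_exp_neg_sub_const, hint, ← ENNReal.ofReal_mul (Real.exp_pos W).le,
      ENNReal.ofReal_lt_ofReal_iff (by positivity)]
    exact routeConstant_lt_exp_mul hδ' hW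
  exact ⟨fun y ↦ f y - W, h1, h2, h3, h4, h5⟩

end Summit.SmoothPoincare4.SmoothPoincare4.Theorems.SubcylindricalRecognition.AncientSphereRigidity

end
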